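import Literature.MathematicalPhysics.QuantumFieldTheory.Balaban1983to89.B8Prop6CubeMemberGaugedBdryBeta
import Literature.MathematicalPhysics.QuantumFieldTheory.Balaban1983to89.B8Thm4ConcreteBdryBeta
import Literature.MathematicalPhysics.QuantumFieldTheory.Balaban1983to89.B8LeafModelZdOfHFP

/-!
# `Balaban1983to89.B8LeafKnitZd3CubBdryBeta` — [Balaban1985RegularSpaces] PROPOSITION 6 (p. 99) ON THE CUBE FAMILY OF (1.131): `H4`-FREE FROM THE FIVE
# SOCKETS IN EDITION β, AND THE BINDER-AGNOSTIC WINDOW-FREE FORM FROM ANY ALL-LEVELS `SockB9P3D4β` FAMILY ON THE CUBE SUB-FAMILY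

statement-level skeleton of published theorems with citation tags; proofs where landed; nothing here is a claim about the
Yang–Mills mass gap

PDF held: `paper:balaban1985-cmp99-regular-spaces-gauge-fixing` (journal page = PDF page + 74); pp. 77, 81–83, 86–88, 94, 98–99.

CITATION HEADER (lean-in-tree rule).  Cell `pub-ymgap` (HUMAN RULING D-0062, Track A), DAG node N05 = [B8], seat `pub-ymgap-dag-n05-e` g8 (R141 (C)
row s3b), 2026-08-27.  WHY: dag-lead RULING №189 (2) (bus l.20717): re-knit the consumer of the N06 → N05 cube-road junction on dag-n06-b's EDITION β
`B9SupplySockB9P3ZdBeta.SockB9P3D4β` (p541339; its member supplier `sockB9P3D4β_at` ∕ family form `sockB9P3D4β_allLevels_of_thm33_on`, A6-witnessed at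
truncation `m = 0` by `Witness.sockB9P3D4β_at_nonvacuous_cube_zero` ∕ `Witness.binders_inhabited_cube_zero`).  The R-d consumer of record (p537045
`prop6Printed_zdCub_of_sockD4Family`) reads `SockB9P3D4`, certified unsatisfiable at the cube members (p539131); ref-E g10 NIT-1 (bus l.20905): β does NOT
plug into it by one application (`|B₁|β ≥ |B₁|`).  THIS FILE is the β consumer: §0 the boundary-layer law at the cube members (`bdryLayer_cubeMember`,
`bdryLayer_cubeSubfamily`); §1 ★ `prop6Printed_zdCub_bdry₅β_d4` — Proposition 6 on `zdCub ∘ f` from the FIVE β sockets, `H4`-FREE (Theorem 4 as printed on the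
cube sub-family served by this seat's β chain `B8Thm4KLevelBdryBeta` → `B8Thm4ConcreteBdryBeta`; the Prop.-3-frame members by `B8Prop6CubeMemberBdryBeta` →
`…GaugedBdryBeta`), + record form; §2 `sockH59Dβ_of_allLevelsD4β` (dag-n06-b's bridge with one token, hosted here on their GO, bus l.20967); §3
`sockB9P3D4β_mono_B₀`; §4 ★★ `prop6Printed_zdCub_of_sockD4βFamily` — the BINDER-AGNOSTIC, WINDOW-FREE consumer: ANY all-levels `SockB9P3D4β` family on the
cube sub-family + Proposition 5's three sockets at the enlarged constant ⟹ `B8.Prop6Printed` on `zdCub ∘ f`.  Kind «kernel-checked proof», theorems only,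
no `def`.

HONEST SCOPE.  (i) Every socket is a HYPOTHESIS: `SockP5base` ∕ `SockP5` ∕ `SockP5u` (Prop. 5 ∃ base∕step∕uniqueness) and the β sockets ([4] Thm 3.3 with
exterior data in the β reading; dag-n06-b's suppliers are A6-witnessed at `m = 0` ONLY — levels `m ≥ 1` = [4] Sect. A + Thm 3.11, object-bound, NOT
witnessed); nothing of them is discharged here, and no satisfiability claim beyond dag-n06-b's witness is made.  A6-PARTIAL (ref-E g10 READ-2∕3 on the R-d′ pair, bus l.21032∕l.21074, carried to β): at a
cube member the boundary pure-gauge mode `A′ = t·d𝟙_{□₀}` of p539131 is a datum of the socket with `J = 0`, `Φ₀ = 0` and `|B₁|β = ηt` (its crossing terms), so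
the β socket text is FALSE below an absolute threshold in `B₀` (line 1 needs `B₀ ≥ 1`; the gradient ∕ `∂*∂` ∕ `Δ` lines a larger absolute constant) — as in
print, where `B₀` is [4] Thm 3.3's constant; dag-n06-b's supplier delivers `B₀′ = max{1, 2B₀max{1,q}}`.  The theorems here hold for every `B₀ > 0`; below
that threshold their socket hypothesis is vacuous (partial vacuity, declared; no satisfiability claim of mine).  (ii) `B_∂`, the enlarged constant `B₀ˢ`
and the merged thresholds are the tree's bookkeeping (print: «B₁ = 5dLB₀ … depend on d and L only», p. 87).  Count-neutral; N05 NOT discharged; one finite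
`𝕋⁴` programme at fixed `ε`, Bałaban as printed; nothing continuum ∕ ℝ⁴ ∕ OS ∕ mass-gap ∕ Clay.  No `sorry`, no `def`, no `instance`, no `notation`.
Unit `pub-ymgap-dag-n05-e` (g8), 2026-08-27.
-/

noncomputable section

open NormedSpace

namespace Literature.MathematicalPhysics.QuantumFieldTheory.Balaban1983to89.B8LeafKnitZd3CubBdryBeta

open MatrixLog B7Prop1Explicit B7Prop2Explicit B7Prop1Local B7Eq92Concrete
open B7Prop4GeneralLevels (logCovIter linCovIter)
open B8Ineq132 (InAk covDerivFwd BondTouches)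
open B8Eq119TwistedAxial (Restr129 InAx)
open B8Eq140Level (SideTouches)
open B8Eq146AExpansion (iEta plaqCovDeriv)
open B8Eq143PlaqExpansion (pdiv)
open B8Eq155JBound (Jcur wsup)
open B8ScaledSupNorm (bondNorm msup)
open B8Eq184Proof (gaugeExp cfgExp)
open B8Eq138LandauZd (IsLandau138W logCfg covLap)
open B8Lemma1NonAbelian (mulCfg)
open B8Ineq130 (tlo thi)
open B8LeafModelZd (ZdIdx SockP5base SockP5 SockP5u)
open B8LeafModelZdOfHFP (sockP5base_anti sockP5_anti sockP5u_anti)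
open B8Eq131CubesAdmissible (cubeFam cubeFam_false_of_le)
open B8CubeMemberZd (cubeLam cubeLamS cubeLamB hΩ_cubeFam hbox_cubeLamB hclass_cubeLamB htower_cubeLam hpart_cubeLam mem_cubeLam_zero_iff cubeLamS_of_lt)
open B9SupplySockB9P3ZdLettersOmega (margin2_cubeFam)
open B9SupplySockB9P3ZdBeta (CrossB SockB9P3D4β)
open B8Prop6CubeMemberGaugedBdryBeta (prop6Printed_zdCub_of_thm4_b9Dβ_d4)
open Node00 (CubeB8 zdCub)

-- `Site` alone could resolve to the torus sites of `Setup.lean`; re-export the `ℤ^d` sites of `B7Prop1Explicit`.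
export B7Prop1Explicit (Site)

variable {d : ℕ}

variable {𝔸 : Type} [CStarAlgebra 𝔸] [Nontrivial 𝔸]

/-! ## §0 The boundary-layer law at the cube members of (1.131) -/

omit [Nontrivial 𝔸] in
/-- **THE BOUNDARY-LAYER LAW AT THE CUBE MEMBER**: for `1 ≤ m ≤ k`, a site of `□₀` with a sup-distance-1 neighbour outside `□₀` is not in `□₁` (the margin
of (1.131), `margin2_cubeFam`), hence lies in `Λ₀ = □₀ ∖ □₁ = cubeLamS … m 0` — the level-0 territory of (1.29), where the gauge transformation is trivial.
(The displayed hypothesis `hlay` of `B8Thm4KLevelBdryBeta` ∕ `B8Thm4ConcreteBdryBeta`, discharged.) [cite: Balaban1985RegularSpaces, (1.131) p.99, (1.29) p.81, (1.5) p.77] -/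
theorem bdryLayer_cubeMember {L : ℕ} (hL : 2 ≤ L) (a : Site d) (M ρ k : ℕ) (hρ : L ≤ ρ) (hk : 1 ≤ k) :
    ∀ m, 1 ≤ m → m ≤ k → ∀ y z : Site d, y ∈ cubeFam false L a M ρ k 0 → z ∉ cubeFam false L a M ρ k 0 →
      (∀ l, y l - 1 ≤ z l ∧ z l ≤ y l + 1) → y ∈ cubeLamS L a M ρ k m 0 := by
  intro m hm1 _ y z hy hz hyz
  have hL1 : 1 ≤ L := le_trans (by norm_num) hL
  have hM2 := margin2_cubeFam L a M (hL.trans hρ) k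
  have hy1 : y ∉ cubeFam false L a M ρ k 1 := fun h1 =>
    hz (hM2 1 le_rfl y h1 z fun l => ⟨by have := (hyz l).1; omega, by have := (hyz l).2; omega⟩)
  have hy0 : y ∈ cubeLam L a M ρ k 0 := by
    rw [mem_cubeLam_zero_iff hL1 a M ρ hk, ← cubeFam_false_of_le L a M ρ (Nat.zero_le k), ← cubeFam_false_of_le L a M ρ hk]
    exact ⟨hy, hy1⟩
  rw [cubeLamS_of_lt L a M ρ k (by omega : 0 < m)]
  exact hy0

omit [Nontrivial 𝔸] in
/-- The boundary-layer law holds at every member of the cube sub-family of (1.131) (`L ≤ ρ`, `L ≥ 2`) — the `hlay` input of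
`B8Thm4ConcreteBdryBeta.thm4Printed_zd3_map_bdryβ` at `ι := Subtype.val`. [cite: Balaban1985RegularSpaces, (1.131) p.99, (1.29) p.81] -/
theorem bdryLayer_cubeSubfamily {L : ℕ} (hL : 2 ≤ L)
    (i : {i : ZdIdx d L // ∃ (a : Site d) (M ρ : ℕ), L ≤ ρ ∧ ρ ≤ M ∧ 11 * d < M ∧ L ≤ d * M ∧
        i.Ω = cubeFam false L a M ρ i.k ∧ i.Λs = cubeLamS L a M ρ i.k ∧ i.Λb = cubeLamB L a M ρ i.k}) :
    ∀ m, 1 ≤ m → m ≤ i.1.k → ∀ y z : Site d, y ∈ i.1.Ω 0 → z ∉ i.1.Ω 0 → (∀ l, y l - 1 ≤ z l ∧ z l ≤ y l + 1) → y ∈ i.1.Λs m 0 := by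
  obtain ⟨a, M, ρ, hρL, -, -, -, hΩ, hΛs, -⟩ := i.2
  rw [hΩ, hΛs]
  exact bdryLayer_cubeMember hL a M ρ i.1.k hρL i.1.hk

/-! ## §1 `B8.Prop6Printed` on `zdCub` and on the member of record from the five sockets in edition β (`H4`-free) -/

/-- ★ **`B8.Prop6Printed` ON `Node00.zdCub` FROM THE FIVE SOCKETS, THE (1.59) SOCKET AND THE PROP.-3-FRAME SOCKET IN EDITION β — `H4`-FREE** —
p525992's `prop6Printed_zdCub_bdry₅_d4` with `SH59D ↦ SH59Dβ` (Theorem 4's frame: `|B₁|β` over `Λb m j ∪ {level-0 crossing bonds}`, the body of `SockB9P3D4β` at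
the induction datum) and the per-cube Prop.-3-frame binder in β (the body of `SockB9P3D4β … c.k …` at background-pair data): Proposition 5 ∃ base ∕ ∃ step ∕
uniqueness and the β (1.59) socket at every member of the cube sub-family (`B8Thm4ConcreteBdryBeta.thm4Printed_zd3_map_bdryβ` serves Theorem 4 as printed
there, the boundary-layer law discharged by `bdryLayer_cubeSubfamily`), and the four-line β socket at every cube (`prop6Printed_zdCub_of_thm4_b9Dβ_d4`).
[cite: Balaban1985RegularSpaces, Prop. 6 p.99, Thm 4 p.88, Prop. 3 p.87, Prop. 5 (1.107)–(1.109) p.94, (1.59) p.86, (1.31) p.82] -/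
theorem prop6Printed_zdCub_bdry₅β_d4 (hd2 : 2 ≤ d) {L : ℕ} (hL : 2 ≤ L) (inp : B8.B9Inputs) {C₂ cB9 cu cP Bbd : ℝ}
    (hB : 2 ≤ 5 * (d : ℝ) * L * inp.B₀) (hC₂ : 2097152 * ((d : ℝ) + 1) ^ 2 ≤ C₂) (hcB9 : 0 < cB9) (hcu : 0 < cu) (hcP : 0 < cP)
    (hBbd : 0 ≤ Bbd) (hBd : 4 * Bbd ≤ ((d : ℝ) * L - 1) * inp.B₀)
    (SP5base : ∀ i : {i : ZdIdx d L // ∃ (a : Site d) (M ρ : ℕ), L ≤ ρ ∧ ρ ≤ M ∧ 11 * d < M ∧ L ≤ d * M ∧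
        i.Ω = cubeFam false L a M ρ i.k ∧ i.Λs = cubeLamS L a M ρ i.k ∧ i.Λb = cubeLamB L a M ρ i.k}, SockP5base (𝔸 := 𝔸) L inp.B₀ inp.B₀' cP i.1.η i.1.k i.1.Ω i.1.Λs)
    (SP5 : ∀ i : {i : ZdIdx d L // ∃ (a : Site d) (M ρ : ℕ), L ≤ ρ ∧ ρ ≤ M ∧ 11 * d < M ∧ L ≤ d * M ∧
        i.Ω = cubeFam false L a M ρ i.k ∧ i.Λs = cubeLamS L a M ρ i.k ∧ i.Λb = cubeLamB L a M ρ i.k}, SockP5 (𝔸 := 𝔸) L inp.B₀ inp.B₀' cP i.1.η i.1.k i.1.Ω i.1.Λs)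
    (SH59Dβ : ∀ i : {i : ZdIdx d L // ∃ (a : Site d) (M ρ : ℕ), L ≤ ρ ∧ ρ ≤ M ∧ 11 * d < M ∧ L ≤ d * M ∧
        i.Ω = cubeFam false L a M ρ i.k ∧ i.Λs = cubeLamS L a M ρ i.k ∧ i.Λb = cubeLamB L a M ρ i.k},
      (∀ α₀ α₁ : ℝ, 0 < α₀ → 0 < α₁ → α₀ + α₁ ≤ cP →
        ∀ U₀ U' : Site d → Fin d → 𝔸ˣ, (∀ x κ, U₀ x κ ∈ unitaryUnits 𝔸) → (∀ x κ, U' x κ ∈ unitaryUnits 𝔸) →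
        InAk L i.1.k i.1.η α₀ i.1.Ω U₀ → InAk L i.1.k i.1.η α₀ i.1.Ω (mulCfg U' U₀) → (∀ m, m ≤ i.1.k → InAx L m (i.1.Λs m) U₀ (mulCfg U' U₀)) →
        (∀ j, j ≤ i.1.k → ∀ (z : Site d) (μ : Fin d), (∀ x, InBox (loK L j z) (bondHiK L j z μ) x → x ∈ i.1.Ω j) →
          ‖(avgIter L (mulCfg U' U₀) j z μ : 𝔸) - (avgIter L U₀ j z μ : 𝔸)‖ ≤ α₁) →
        (∀ b ∈ {b : Site d × Fin d | SideTouches (i.1.Ω 0) b.1 b.2}, ‖((U' b.1 b.2 : 𝔸ˣ) : 𝔸) - 1‖ ≤ α₁) →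
        (∀ m, 1 ≤ m → m ≤ i.1.k → ∀ (u : Site d → 𝔸ˣ) (W : Site d → Fin d → 𝔸ˣ) (A' : Site d → Fin d → 𝔸),
          (∀ x, u x ∈ unitaryUnits 𝔸) → (∀ x, x ∉ i.1.Ω 0 → u x = 1) → mgauge U₀ u W = U' → Restr129 L m (i.1.Λs m) U₀ u →
          IsLandau138W L m i.1.η (i.1.Ω 0) (i.1.Λs m) U₀ W → (∀ y τ, IsSelfAdjoint (A' y τ)) →
          (∀ j, j ≤ m → ∀ y τ, SideTouches (i.1.Ω j) y τ →
          W y τ = cfgExp i.1.η A' y τ ∧ ‖A' y τ‖ ≤ (2 * (L * (5 * (d : ℝ) * L * inp.B₀ * (α₀ + α₁))) + 8 * (8 * inp.B₀' * (5 * (d : ℝ) * L * inp.B₀) * (α₀ + α₁))) * ((L : ℝ) ^ j * i.1.η)⁻¹) →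
          (∀ y τ, (∀ j, j ≤ m → ¬ SideTouches (i.1.Ω j) y τ) → A' y τ = 0) →
          msup L m i.1.η (-(1 : ℝ)) (fun j (b : Site d × Fin d) => SideTouches (i.1.Ω j) b.1 b.2) (fun b => A' b.1 b.2)
          ≤ inp.B₀ * (bondNorm L m i.1.η (-(3 : ℝ)) i.1.Ω (fun x μ => Jcur i.1.η U₀ A' μ x)
          + wsup 1 (fun p : {p : ℕ × (Site d × Fin d) // p.1 ≤ m ∧ (p.2 ∈ i.1.Λb m p.1 ∨ (p.1 = 0 ∧ CrossB (i.1.Ω 0) p.2))} =>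
          linCovIter L U₀ (iEta i.1.η A') p.1.1 p.1.2.1 p.1.2.2))
          + Bbd * msup L m i.1.η (-(1 : ℝ)) (fun j (b : Site d × Fin d) => j = 0 ∧ SideTouches (i.1.Ω 0) b.1 b.2 ∧ ¬ BondTouches (i.1.Ω 0) b.1 b.2)
              (fun b => A' b.1 b.2) ∧
          msup L m i.1.η (-(2 : ℝ)) (fun j (t : Fin d × Fin d × Site d) => SideTouches (i.1.Ω j) t.2.2 t.2.1)
          (fun t => covDerivFwd i.1.η U₀ t.1 (fun z => A' z t.2.1) t.2.2)
          ≤ inp.B₀ * (bondNorm L m i.1.η (-(3 : ℝ)) i.1.Ω (fun x μ => Jcur i.1.η U₀ A' μ x)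
          + wsup 1 (fun p : {p : ℕ × (Site d × Fin d) // p.1 ≤ m ∧ (p.2 ∈ i.1.Λb m p.1 ∨ (p.1 = 0 ∧ CrossB (i.1.Ω 0) p.2))} =>
          linCovIter L U₀ (iEta i.1.η A') p.1.1 p.1.2.1 p.1.2.2))
          + Bbd * msup L m i.1.η (-(1 : ℝ)) (fun j (b : Site d × Fin d) => j = 0 ∧ SideTouches (i.1.Ω 0) b.1 b.2 ∧ ¬ BondTouches (i.1.Ω 0) b.1 b.2)
              (fun b => A' b.1 b.2))))
    (SP5u : ∀ i : {i : ZdIdx d L // ∃ (a : Site d) (M ρ : ℕ), L ≤ ρ ∧ ρ ≤ M ∧ 11 * d < M ∧ L ≤ d * M ∧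
        i.Ω = cubeFam false L a M ρ i.k ∧ i.Λs = cubeLamS L a M ρ i.k ∧ i.Λb = cubeLamB L a M ρ i.k}, SockP5u (𝔸 := 𝔸) L cP cu i.1.η i.1.k i.1.Ω i.1.Λs) :
    ∃ c₁ : ℝ, 0 < c₁ ∧ ∀ {ι : Type} (f : ι → ZdIdx d L),
      (∀ (jf : ι) (c : CubeB8 d L (f jf).k (f jf).Ω),
      (∀ α₀ α₂ : ℝ, 0 < α₀ → α₀ ≤ cB9 → 0 < α₂ → α₂ ≤ cB9 →
      ∀ (U₀ W : Site d → Fin d → 𝔸ˣ), (∀ x κ, U₀ x κ ∈ unitaryUnits 𝔸) → (∀ x κ, W x κ ∈ unitaryUnits 𝔸) →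
      InAk L c.k (f jf).η α₀ (cubeFam false L c.a c.M c.ρ c.k) U₀ → InAk L c.k (f jf).η α₀ (cubeFam false L c.a c.M c.ρ c.k) (mulCfg W U₀) → IsLandau138W L c.k (f jf).η ((cubeFam false L c.a c.M c.ρ c.k) 0) (cubeLamS L c.a c.M c.ρ c.k c.k) U₀ W →
      ∀ A' : Site d → Fin d → 𝔸, (∀ y τ, IsSelfAdjoint (A' y τ)) →
      (∀ j, j ≤ c.k → ∀ (y : Site d) (τ : Fin d), SideTouches ((cubeFam false L c.a c.M c.ρ c.k) j) y τ →
      W y τ = cfgExp (f jf).η A' y τ ∧ ‖A' y τ‖ ≤ α₂ * ((L : ℝ) ^ j * (f jf).η)⁻¹) →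
      (∀ (y : Site d) (τ : Fin d), (∀ j, j ≤ c.k → ¬ SideTouches ((cubeFam false L c.a c.M c.ρ c.k) j) y τ) → A' y τ = 0) →
      msup L c.k (f jf).η (-(1 : ℝ)) (fun j (b : Site d × Fin d) => SideTouches ((cubeFam false L c.a c.M c.ρ c.k) j) b.1 b.2) (fun b => A' b.1 b.2)
      ≤ inp.B₀ * (bondNorm L c.k (f jf).η (-(3 : ℝ)) (cubeFam false L c.a c.M c.ρ c.k) (fun x μ => Jcur (f jf).η U₀ A' μ x)
      + wsup 1 (fun p : {p : ℕ × (Site d × Fin d) // p.1 ≤ c.k ∧ (p.2 ∈ cubeLamB L c.a c.M c.ρ c.k c.k p.1 ∨ (p.1 = 0 ∧ CrossB ((cubeFam false L c.a c.M c.ρ c.k) 0) p.2))} =>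
      linCovIter L U₀ (iEta (f jf).η A') p.1.1 p.1.2.1 p.1.2.2)) + Bbd * msup L c.k (f jf).η (-(1 : ℝ))
      (fun j (b : Site d × Fin d) => j = 0 ∧ SideTouches ((cubeFam false L c.a c.M c.ρ c.k) 0) b.1 b.2 ∧ ¬ BondTouches ((cubeFam false L c.a c.M c.ρ c.k) 0) b.1 b.2)
      (fun b => A' b.1 b.2) ∧
      msup L c.k (f jf).η (-(2 : ℝ)) (fun j (t : Fin d × Fin d × Site d) => SideTouches ((cubeFam false L c.a c.M c.ρ c.k) j) t.2.2 t.2.1)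
      (fun t => covDerivFwd (f jf).η U₀ t.1 (fun z => A' z t.2.1) t.2.2)
      ≤ inp.B₀ * (bondNorm L c.k (f jf).η (-(3 : ℝ)) (cubeFam false L c.a c.M c.ρ c.k) (fun x μ => Jcur (f jf).η U₀ A' μ x)
      + wsup 1 (fun p : {p : ℕ × (Site d × Fin d) // p.1 ≤ c.k ∧ (p.2 ∈ cubeLamB L c.a c.M c.ρ c.k c.k p.1 ∨ (p.1 = 0 ∧ CrossB ((cubeFam false L c.a c.M c.ρ c.k) 0) p.2))} =>
      linCovIter L U₀ (iEta (f jf).η A') p.1.1 p.1.2.1 p.1.2.2)) + Bbd * msup L c.k (f jf).η (-(1 : ℝ))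
      (fun j (b : Site d × Fin d) => j = 0 ∧ SideTouches ((cubeFam false L c.a c.M c.ρ c.k) 0) b.1 b.2 ∧ ¬ BondTouches ((cubeFam false L c.a c.M c.ρ c.k) 0) b.1 b.2)
      (fun b => A' b.1 b.2) ∧
      bondNorm L c.k (f jf).η (-(3 : ℝ)) (cubeFam false L c.a c.M c.ρ c.k) (fun x μ => pdiv (f jf).η U₀ (plaqCovDeriv (f jf).η U₀ A') μ x)
      ≤ inp.B₀ * (bondNorm L c.k (f jf).η (-(3 : ℝ)) (cubeFam false L c.a c.M c.ρ c.k) (fun x μ => Jcur (f jf).η U₀ A' μ x)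
      + wsup 1 (fun p : {p : ℕ × (Site d × Fin d) // p.1 ≤ c.k ∧ (p.2 ∈ cubeLamB L c.a c.M c.ρ c.k c.k p.1 ∨ (p.1 = 0 ∧ CrossB ((cubeFam false L c.a c.M c.ρ c.k) 0) p.2))} =>
      linCovIter L U₀ (iEta (f jf).η A') p.1.1 p.1.2.1 p.1.2.2)) + Bbd * msup L c.k (f jf).η (-(1 : ℝ))
      (fun j (b : Site d × Fin d) => j = 0 ∧ SideTouches ((cubeFam false L c.a c.M c.ρ c.k) 0) b.1 b.2 ∧ ¬ BondTouches ((cubeFam false L c.a c.M c.ρ c.k) 0) b.1 b.2)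
      (fun b => A' b.1 b.2) ∧
      bondNorm L c.k (f jf).η (-(3 : ℝ)) (cubeFam false L c.a c.M c.ρ c.k) (fun x μ => covLap (f jf).η U₀ (fun z => A' z μ) x)
      ≤ inp.B₀ * (bondNorm L c.k (f jf).η (-(3 : ℝ)) (cubeFam false L c.a c.M c.ρ c.k) (fun x μ => Jcur (f jf).η U₀ A' μ x)
      + wsup 1 (fun p : {p : ℕ × (Site d × Fin d) // p.1 ≤ c.k ∧ (p.2 ∈ cubeLamB L c.a c.M c.ρ c.k c.k p.1 ∨ (p.1 = 0 ∧ CrossB ((cubeFam false L c.a c.M c.ρ c.k) 0) p.2))} =>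
      linCovIter L U₀ (iEta (f jf).η A') p.1.1 p.1.2.1 p.1.2.2)) + Bbd * msup L c.k (f jf).η (-(1 : ℝ))
      (fun j (b : Site d × Fin d) => j = 0 ∧ SideTouches ((cubeFam false L c.a c.M c.ρ c.k) 0) b.1 b.2 ∧ ¬ BondTouches ((cubeFam false L c.a c.M c.ρ c.k) 0) b.1 b.2)
      (fun b => A' b.1 b.2))) →
      B8.Prop6Printed d (L : ℝ) (5 * (d : ℝ) * L * inp.B₀) c₁ (fun j => zdCub 𝔸 L (f j)) :=
  prop6Printed_zdCub_of_thm4_b9Dβ_d4 (𝔸 := 𝔸) hd2 hL inp hC₂ hcB9 hBbd hBd 0 (fun _ => (0 : ℝ))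
    (B8Thm4ConcreteBdryBeta.thm4Printed_zd3_map_bdryβ (𝔸 := 𝔸) hd2 hL inp.B₀_pos inp.B₀'_pos hB hcu hcP hBbd hBd
      (Subtype.val : {i : ZdIdx d L // ∃ (a : Site d) (M ρ : ℕ), L ≤ ρ ∧ ρ ≤ M ∧ 11 * d < M ∧ L ≤ d * M ∧
        i.Ω = cubeFam false L a M ρ i.k ∧ i.Λs = cubeLamS L a M ρ i.k ∧ i.Λb = cubeLamB L a M ρ i.k} → ZdIdx d L)
      (fun j => bdryLayer_cubeSubfamily hL j) SP5base SP5 SH59Dβ SP5u)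

#print axioms prop6Printed_zdCub_bdry₅β_d4

/-- **`B8.Prop6Printed` ON NODE 00's MEMBER OF RECORD `Node00.cubB8OfRecord θ` FROM THE FIVE β SOCKETS** — the `p6` letter for the record knits
in edition β: `prop6Printed_zdCub_bdry₅β_d4` at `f := Subtype.val`. [cite: Balaban1985RegularSpaces, Prop. 6 p.99, Thm 4 p.88, Prop. 3 p.87, Prop. 5 p.94, (1.59) p.86] -/
theorem prop6Printed_cubB8OfRecord_bdry₅β_d4 (θ : Node00.Stage3Params) (hD : 2 ≤ θ.D) (inp : B8.B9Inputs) {C₂ cB9 cu cP Bbd : ℝ}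
    (hB : 2 ≤ 5 * (θ.D : ℝ) * θ.L * inp.B₀) (hC₂ : 2097152 * ((θ.D : ℝ) + 1) ^ 2 ≤ C₂) (hcB9 : 0 < cB9) (hcu : 0 < cu) (hcP : 0 < cP)
    (hBbd : 0 ≤ Bbd) (hBd : 4 * Bbd ≤ ((θ.D : ℝ) * θ.L - 1) * inp.B₀)
    (SP5base : ∀ i : {i : ZdIdx θ.D θ.L // ∃ (a : Site θ.D) (M ρ : ℕ), θ.L ≤ ρ ∧ ρ ≤ M ∧ 11 * θ.D < M ∧ θ.L ≤ θ.D * M ∧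
        i.Ω = cubeFam false θ.L a M ρ i.k ∧ i.Λs = cubeLamS θ.L a M ρ i.k ∧ i.Λb = cubeLamB θ.L a M ρ i.k}, SockP5base (𝔸 := θ.𝔸) θ.L inp.B₀ inp.B₀' cP i.1.η i.1.k i.1.Ω i.1.Λs)
    (SP5 : ∀ i : {i : ZdIdx θ.D θ.L // ∃ (a : Site θ.D) (M ρ : ℕ), θ.L ≤ ρ ∧ ρ ≤ M ∧ 11 * θ.D < M ∧ θ.L ≤ θ.D * M ∧
        i.Ω = cubeFam false θ.L a M ρ i.k ∧ i.Λs = cubeLamS θ.L a M ρ i.k ∧ i.Λb = cubeLamB θ.L a M ρ i.k}, SockP5 (𝔸 := θ.𝔸) θ.L inp.B₀ inp.B₀' cP i.1.η i.1.k i.1.Ω i.1.Λs)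
    (SH59Dβ : ∀ i : {i : ZdIdx θ.D θ.L // ∃ (a : Site θ.D) (M ρ : ℕ), θ.L ≤ ρ ∧ ρ ≤ M ∧ 11 * θ.D < M ∧ θ.L ≤ θ.D * M ∧
        i.Ω = cubeFam false θ.L a M ρ i.k ∧ i.Λs = cubeLamS θ.L a M ρ i.k ∧ i.Λb = cubeLamB θ.L a M ρ i.k},
      (∀ α₀ α₁ : ℝ, 0 < α₀ → 0 < α₁ → α₀ + α₁ ≤ cP →
        ∀ U₀ U' : Site θ.D → Fin θ.D → θ.𝔸ˣ, (∀ x κ, U₀ x κ ∈ unitaryUnits θ.𝔸) → (∀ x κ, U' x κ ∈ unitaryUnits θ.𝔸) →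
        InAk θ.L i.1.k i.1.η α₀ i.1.Ω U₀ → InAk θ.L i.1.k i.1.η α₀ i.1.Ω (mulCfg U' U₀) → (∀ m, m ≤ i.1.k → InAx θ.L m (i.1.Λs m) U₀ (mulCfg U' U₀)) →
        (∀ j, j ≤ i.1.k → ∀ (z : Site θ.D) (μ : Fin θ.D), (∀ x, InBox (loK θ.L j z) (bondHiK θ.L j z μ) x → x ∈ i.1.Ω j) →
          ‖(avgIter θ.L (mulCfg U' U₀) j z μ : θ.𝔸) - (avgIter θ.L U₀ j z μ : θ.𝔸)‖ ≤ α₁) →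
        (∀ b ∈ {b : Site θ.D × Fin θ.D | SideTouches (i.1.Ω 0) b.1 b.2}, ‖((U' b.1 b.2 : θ.𝔸ˣ) : θ.𝔸) - 1‖ ≤ α₁) →
        (∀ m, 1 ≤ m → m ≤ i.1.k → ∀ (u : Site θ.D → θ.𝔸ˣ) (W : Site θ.D → Fin θ.D → θ.𝔸ˣ) (A' : Site θ.D → Fin θ.D → θ.𝔸),
          (∀ x, u x ∈ unitaryUnits θ.𝔸) → (∀ x, x ∉ i.1.Ω 0 → u x = 1) → mgauge U₀ u W = U' → Restr129 θ.L m (i.1.Λs m) U₀ u →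
          IsLandau138W θ.L m i.1.η (i.1.Ω 0) (i.1.Λs m) U₀ W → (∀ y τ, IsSelfAdjoint (A' y τ)) →
          (∀ j, j ≤ m → ∀ y τ, SideTouches (i.1.Ω j) y τ →
          W y τ = cfgExp i.1.η A' y τ ∧ ‖A' y τ‖ ≤ (2 * (θ.L * (5 * (θ.D : ℝ) * θ.L * inp.B₀ * (α₀ + α₁))) + 8 * (8 * inp.B₀' * (5 * (θ.D : ℝ) * θ.L * inp.B₀) * (α₀ + α₁))) * ((θ.L : ℝ) ^ j * i.1.η)⁻¹) →
          (∀ y τ, (∀ j, j ≤ m → ¬ SideTouches (i.1.Ω j) y τ) → A' y τ = 0) →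
          msup θ.L m i.1.η (-(1 : ℝ)) (fun j (b : Site θ.D × Fin θ.D) => SideTouches (i.1.Ω j) b.1 b.2) (fun b => A' b.1 b.2)
          ≤ inp.B₀ * (bondNorm θ.L m i.1.η (-(3 : ℝ)) i.1.Ω (fun x μ => Jcur i.1.η U₀ A' μ x)
          + wsup 1 (fun p : {p : ℕ × (Site θ.D × Fin θ.D) // p.1 ≤ m ∧ (p.2 ∈ i.1.Λb m p.1 ∨ (p.1 = 0 ∧ CrossB (i.1.Ω 0) p.2))} =>
          linCovIter θ.L U₀ (iEta i.1.η A') p.1.1 p.1.2.1 p.1.2.2))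
          + Bbd * msup θ.L m i.1.η (-(1 : ℝ)) (fun j (b : Site θ.D × Fin θ.D) => j = 0 ∧ SideTouches (i.1.Ω 0) b.1 b.2 ∧ ¬ BondTouches (i.1.Ω 0) b.1 b.2)
              (fun b => A' b.1 b.2) ∧
          msup θ.L m i.1.η (-(2 : ℝ)) (fun j (t : Fin θ.D × Fin θ.D × Site θ.D) => SideTouches (i.1.Ω j) t.2.2 t.2.1)
          (fun t => covDerivFwd i.1.η U₀ t.1 (fun z => A' z t.2.1) t.2.2)
          ≤ inp.B₀ * (bondNorm θ.L m i.1.η (-(3 : ℝ)) i.1.Ω (fun x μ => Jcur i.1.η U₀ A' μ x)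
          + wsup 1 (fun p : {p : ℕ × (Site θ.D × Fin θ.D) // p.1 ≤ m ∧ (p.2 ∈ i.1.Λb m p.1 ∨ (p.1 = 0 ∧ CrossB (i.1.Ω 0) p.2))} =>
          linCovIter θ.L U₀ (iEta i.1.η A') p.1.1 p.1.2.1 p.1.2.2))
          + Bbd * msup θ.L m i.1.η (-(1 : ℝ)) (fun j (b : Site θ.D × Fin θ.D) => j = 0 ∧ SideTouches (i.1.Ω 0) b.1 b.2 ∧ ¬ BondTouches (i.1.Ω 0) b.1 b.2)
              (fun b => A' b.1 b.2))))
    (SP5u : ∀ i : {i : ZdIdx θ.D θ.L // ∃ (a : Site θ.D) (M ρ : ℕ), θ.L ≤ ρ ∧ ρ ≤ M ∧ 11 * θ.D < M ∧ θ.L ≤ θ.D * M ∧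
        i.Ω = cubeFam false θ.L a M ρ i.k ∧ i.Λs = cubeLamS θ.L a M ρ i.k ∧ i.Λb = cubeLamB θ.L a M ρ i.k}, SockP5u (𝔸 := θ.𝔸) θ.L cP cu i.1.η i.1.k i.1.Ω i.1.Λs) :
    ∃ c₁ : ℝ, 0 < c₁ ∧
      ((∀ (jf : Node00.IdxB8 θ) (c : CubeB8 θ.D θ.L jf.1.k jf.1.Ω),
      (∀ α₀ α₂ : ℝ, 0 < α₀ → α₀ ≤ cB9 → 0 < α₂ → α₂ ≤ cB9 →
      ∀ (U₀ W : Site θ.D → Fin θ.D → θ.𝔸ˣ), (∀ x κ, U₀ x κ ∈ unitaryUnits θ.𝔸) → (∀ x κ, W x κ ∈ unitaryUnits θ.𝔸) →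
      InAk θ.L c.k jf.1.η α₀ (cubeFam false θ.L c.a c.M c.ρ c.k) U₀ → InAk θ.L c.k jf.1.η α₀ (cubeFam false θ.L c.a c.M c.ρ c.k) (mulCfg W U₀) → IsLandau138W θ.L c.k jf.1.η ((cubeFam false θ.L c.a c.M c.ρ c.k) 0) (cubeLamS θ.L c.a c.M c.ρ c.k c.k) U₀ W →
      ∀ A' : Site θ.D → Fin θ.D → θ.𝔸, (∀ y τ, IsSelfAdjoint (A' y τ)) →
      (∀ j, j ≤ c.k → ∀ (y : Site θ.D) (τ : Fin θ.D), SideTouches ((cubeFam false θ.L c.a c.M c.ρ c.k) j) y τ →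
      W y τ = cfgExp jf.1.η A' y τ ∧ ‖A' y τ‖ ≤ α₂ * ((θ.L : ℝ) ^ j * jf.1.η)⁻¹) →
      (∀ (y : Site θ.D) (τ : Fin θ.D), (∀ j, j ≤ c.k → ¬ SideTouches ((cubeFam false θ.L c.a c.M c.ρ c.k) j) y τ) → A' y τ = 0) →
      msup θ.L c.k jf.1.η (-(1 : ℝ)) (fun j (b : Site θ.D × Fin θ.D) => SideTouches ((cubeFam false θ.L c.a c.M c.ρ c.k) j) b.1 b.2) (fun b => A' b.1 b.2)
      ≤ inp.B₀ * (bondNorm θ.L c.k jf.1.η (-(3 : ℝ)) (cubeFam false θ.L c.a c.M c.ρ c.k) (fun x μ => Jcur jf.1.η U₀ A' μ x)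
      + wsup 1 (fun p : {p : ℕ × (Site θ.D × Fin θ.D) // p.1 ≤ c.k ∧ (p.2 ∈ cubeLamB θ.L c.a c.M c.ρ c.k c.k p.1 ∨ (p.1 = 0 ∧ CrossB ((cubeFam false θ.L c.a c.M c.ρ c.k) 0) p.2))} =>
      linCovIter θ.L U₀ (iEta jf.1.η A') p.1.1 p.1.2.1 p.1.2.2)) + Bbd * msup θ.L c.k jf.1.η (-(1 : ℝ))
      (fun j (b : Site θ.D × Fin θ.D) => j = 0 ∧ SideTouches ((cubeFam false θ.L c.a c.M c.ρ c.k) 0) b.1 b.2 ∧ ¬ BondTouches ((cubeFam false θ.L c.a c.M c.ρ c.k) 0) b.1 b.2)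
      (fun b => A' b.1 b.2) ∧
      msup θ.L c.k jf.1.η (-(2 : ℝ)) (fun j (t : Fin θ.D × Fin θ.D × Site θ.D) => SideTouches ((cubeFam false θ.L c.a c.M c.ρ c.k) j) t.2.2 t.2.1)
      (fun t => covDerivFwd jf.1.η U₀ t.1 (fun z => A' z t.2.1) t.2.2)
      ≤ inp.B₀ * (bondNorm θ.L c.k jf.1.η (-(3 : ℝ)) (cubeFam false θ.L c.a c.M c.ρ c.k) (fun x μ => Jcur jf.1.η U₀ A' μ x)
      + wsup 1 (fun p : {p : ℕ × (Site θ.D × Fin θ.D) // p.1 ≤ c.k ∧ (p.2 ∈ cubeLamB θ.L c.a c.M c.ρ c.k c.k p.1 ∨ (p.1 = 0 ∧ CrossB ((cubeFam false θ.L c.a c.M c.ρ c.k) 0) p.2))} =>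
      linCovIter θ.L U₀ (iEta jf.1.η A') p.1.1 p.1.2.1 p.1.2.2)) + Bbd * msup θ.L c.k jf.1.η (-(1 : ℝ))
      (fun j (b : Site θ.D × Fin θ.D) => j = 0 ∧ SideTouches ((cubeFam false θ.L c.a c.M c.ρ c.k) 0) b.1 b.2 ∧ ¬ BondTouches ((cubeFam false θ.L c.a c.M c.ρ c.k) 0) b.1 b.2)
      (fun b => A' b.1 b.2) ∧
      bondNorm θ.L c.k jf.1.η (-(3 : ℝ)) (cubeFam false θ.L c.a c.M c.ρ c.k) (fun x μ => pdiv jf.1.η U₀ (plaqCovDeriv jf.1.η U₀ A') μ x)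
      ≤ inp.B₀ * (bondNorm θ.L c.k jf.1.η (-(3 : ℝ)) (cubeFam false θ.L c.a c.M c.ρ c.k) (fun x μ => Jcur jf.1.η U₀ A' μ x)
      + wsup 1 (fun p : {p : ℕ × (Site θ.D × Fin θ.D) // p.1 ≤ c.k ∧ (p.2 ∈ cubeLamB θ.L c.a c.M c.ρ c.k c.k p.1 ∨ (p.1 = 0 ∧ CrossB ((cubeFam false θ.L c.a c.M c.ρ c.k) 0) p.2))} =>
      linCovIter θ.L U₀ (iEta jf.1.η A') p.1.1 p.1.2.1 p.1.2.2)) + Bbd * msup θ.L c.k jf.1.η (-(1 : ℝ))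
      (fun j (b : Site θ.D × Fin θ.D) => j = 0 ∧ SideTouches ((cubeFam false θ.L c.a c.M c.ρ c.k) 0) b.1 b.2 ∧ ¬ BondTouches ((cubeFam false θ.L c.a c.M c.ρ c.k) 0) b.1 b.2)
      (fun b => A' b.1 b.2) ∧
      bondNorm θ.L c.k jf.1.η (-(3 : ℝ)) (cubeFam false θ.L c.a c.M c.ρ c.k) (fun x μ => covLap jf.1.η U₀ (fun z => A' z μ) x)
      ≤ inp.B₀ * (bondNorm θ.L c.k jf.1.η (-(3 : ℝ)) (cubeFam false θ.L c.a c.M c.ρ c.k) (fun x μ => Jcur jf.1.η U₀ A' μ x)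
      + wsup 1 (fun p : {p : ℕ × (Site θ.D × Fin θ.D) // p.1 ≤ c.k ∧ (p.2 ∈ cubeLamB θ.L c.a c.M c.ρ c.k c.k p.1 ∨ (p.1 = 0 ∧ CrossB ((cubeFam false θ.L c.a c.M c.ρ c.k) 0) p.2))} =>
      linCovIter θ.L U₀ (iEta jf.1.η A') p.1.1 p.1.2.1 p.1.2.2)) + Bbd * msup θ.L c.k jf.1.η (-(1 : ℝ))
      (fun j (b : Site θ.D × Fin θ.D) => j = 0 ∧ SideTouches ((cubeFam false θ.L c.a c.M c.ρ c.k) 0) b.1 b.2 ∧ ¬ BondTouches ((cubeFam false θ.L c.a c.M c.ρ c.k) 0) b.1 b.2)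
      (fun b => A' b.1 b.2))) →
      B8.Prop6Printed θ.D (θ.L : ℝ) (5 * (θ.D : ℝ) * θ.L * inp.B₀) c₁ (Node00.cubB8OfRecord θ))  := by
  obtain ⟨c₁, hc₁, G⟩ := prop6Printed_zdCub_bdry₅β_d4 (𝔸 := θ.𝔸) hD θ.two_le_L inp hB hC₂ hcB9 hcu hcP hBbd hBd SP5base SP5 SH59Dβ SP5u
  exact ⟨c₁, hc₁, fun S => G (fun i : Node00.IdxB8 θ => i.1) S⟩

#print axioms prop6Printed_cubB8OfRecord_bdry₅β_d4

/-! ## §2 Theorem 4's socket in the β shape (`SH59Dβ`) from the all-levels four-line β collar socket -/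

/-- ★ **THEOREM 4's b9 SOCKET IN THE β SHAPE `SH59Dβ` FROM THE ALL-LEVELS FOUR-LINE β COLLAR SOCKET** — dag-n06-b's
`B9SupplySockB9P3ZdOmega.sockH59D_of_allLevelsD4` VERBATIM with `SockB9P3D4 ↦ SockB9P3D4β` (hosted here with dag-n06-b g11's GO, bus l.20967): below
`min cP (cP ∕ K₀)`, `K₀ = 2L·5dLB₀ + 8·8B₀′·5dLB₀`, the datum `(u, W, A′)` of Theorem 4's induction at level `m` is a datum of `SockB9P3D4β` at level `m`, and
its first two lines, `|B₁|β` and exterior-collar term included, are the conclusion — EXACTLY the inline `SH59Dβ` hypothesis of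
`B8Thm4ConcreteBdryBeta.thm4Body_member_zd3_bdryβ` ∕ `thm4Printed_zd3_map_bdryβ`.
[cite: Balaban1985RegularSpaces, (1.59) p.86, Thm 4 p.88 («the same conditions for k − 1»), (1.69) p.88, (1.31) p.82] -/
theorem sockH59Dβ_of_allLevelsD4β (hd : 1 ≤ d) {L : ℕ} (hL : 1 ≤ L) {B₀ B₀' Bbd cP : ℝ} (hB₀ : 0 < B₀) (hB₀' : 0 ≤ B₀') (hcP : 0 < cP)
    {η : ℝ} {k : ℕ} {Ω : ℕ → Set (Site d)} {Λs : ℕ → ℕ → Set (Site d)} {Λb : ℕ → ℕ → Set (Site d × Fin d)}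
    (H : ∀ m, m ≤ k → SockB9P3D4β (𝔸 := 𝔸) L B₀ Bbd cP η m Ω Λs Λb) :
    ∀ α₀ α₁ : ℝ, 0 < α₀ → 0 < α₁ → α₀ + α₁ ≤ min cP (cP / (2 * (L * (5 * (d : ℝ) * L * B₀)) + 8 * (8 * B₀' * (5 * (d : ℝ) * L * B₀)))) →
      ∀ U₀ U' : Site d → Fin d → 𝔸ˣ, (∀ x κ, U₀ x κ ∈ unitaryUnits 𝔸) → (∀ x κ, U' x κ ∈ unitaryUnits 𝔸) →
      InAk L k η α₀ Ω U₀ → InAk L k η α₀ Ω (mulCfg U' U₀) → (∀ m, m ≤ k → InAx L m (Λs m) U₀ (mulCfg U' U₀)) →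
      (∀ j, j ≤ k → ∀ (z : Site d) (μ : Fin d), (∀ x, InBox (loK L j z) (bondHiK L j z μ) x → x ∈ Ω j) →
        ‖(avgIter L (mulCfg U' U₀) j z μ : 𝔸) - (avgIter L U₀ j z μ : 𝔸)‖ ≤ α₁) →
      (∀ b ∈ {b : Site d × Fin d | SideTouches (Ω 0) b.1 b.2}, ‖((U' b.1 b.2 : 𝔸ˣ) : 𝔸) - 1‖ ≤ α₁) →
      (∀ m, 1 ≤ m → m ≤ k → ∀ (u : Site d → 𝔸ˣ) (W : Site d → Fin d → 𝔸ˣ) (A' : Site d → Fin d → 𝔸),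
        (∀ x, u x ∈ unitaryUnits 𝔸) → (∀ x, x ∉ Ω 0 → u x = 1) → mgauge U₀ u W = U' → Restr129 L m (Λs m) U₀ u →
        IsLandau138W L m η (Ω 0) (Λs m) U₀ W → (∀ y τ, IsSelfAdjoint (A' y τ)) →
        (∀ j, j ≤ m → ∀ y τ, SideTouches (Ω j) y τ →
        W y τ = cfgExp η A' y τ ∧ ‖A' y τ‖ ≤ (2 * (L * (5 * (d : ℝ) * L * B₀ * (α₀ + α₁))) + 8 * (8 * B₀' * (5 * (d : ℝ) * L * B₀) * (α₀ + α₁))) * ((L : ℝ) ^ j * η)⁻¹) →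
        (∀ y τ, (∀ j, j ≤ m → ¬ SideTouches (Ω j) y τ) → A' y τ = 0) →
        msup L m η (-(1 : ℝ)) (fun j (b : Site d × Fin d) => SideTouches (Ω j) b.1 b.2) (fun b => A' b.1 b.2)
        ≤ B₀ * (bondNorm L m η (-(3 : ℝ)) Ω (fun x μ => Jcur η U₀ A' μ x)
        + wsup 1 (fun p : {p : ℕ × (Site d × Fin d) // p.1 ≤ m ∧ (p.2 ∈ Λb m p.1 ∨ (p.1 = 0 ∧ CrossB (Ω 0) p.2))} =>
        linCovIter L U₀ (iEta η A') p.1.1 p.1.2.1 p.1.2.2))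
        + Bbd * msup L m η (-(1 : ℝ)) (fun j (b : Site d × Fin d) => j = 0 ∧ SideTouches (Ω 0) b.1 b.2 ∧ ¬ BondTouches (Ω 0) b.1 b.2)
            (fun b => A' b.1 b.2) ∧
        msup L m η (-(2 : ℝ)) (fun j (t : Fin d × Fin d × Site d) => SideTouches (Ω j) t.2.2 t.2.1)
        (fun t => covDerivFwd η U₀ t.1 (fun z => A' z t.2.1) t.2.2)
        ≤ B₀ * (bondNorm L m η (-(3 : ℝ)) Ω (fun x μ => Jcur η U₀ A' μ x)
        + wsup 1 (fun p : {p : ℕ × (Site d × Fin d) // p.1 ≤ m ∧ (p.2 ∈ Λb m p.1 ∨ (p.1 = 0 ∧ CrossB (Ω 0) p.2))} =>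
        linCovIter L U₀ (iEta η A') p.1.1 p.1.2.1 p.1.2.2))
        + Bbd * msup L m η (-(1 : ℝ)) (fun j (b : Site d × Fin d) => j = 0 ∧ SideTouches (Ω 0) b.1 b.2 ∧ ¬ BondTouches (Ω 0) b.1 b.2)
            (fun b => A' b.1 b.2)) := by
  set K₀ : ℝ := 2 * (L * (5 * (d : ℝ) * L * B₀)) + 8 * (8 * B₀' * (5 * (d : ℝ) * L * B₀)) with hK₀_def
  have hL' : (1 : ℝ) ≤ L := by exact_mod_cast hL
  have hd' : (1 : ℝ) ≤ d := by exact_mod_cast hd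
  have hK₀ : 0 < K₀ := by
    have h1 : 0 < 2 * (L * (5 * (d : ℝ) * L * B₀)) := by positivity
    have h2 : 0 ≤ 8 * (8 * B₀' * (5 * (d : ℝ) * L * B₀)) := by positivity
    linarith
  intro α₀ α₁ hα₀ hα₁ hs U₀ U' hU₀ hU' h33 h34 _ _ _ m _ hmk u W A' hu _ hW _ hLan hsa hWA hA0
  -- the smallness constant of the datum and the guard of the level-`m` socket
  set K : ℝ := 2 * (L * (5 * (d : ℝ) * L * B₀ * (α₀ + α₁))) + 8 * (8 * B₀' * (5 * (d : ℝ) * L * B₀) * (α₀ + α₁)) with hK_def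
  have hKK₀ : K = K₀ * (α₀ + α₁) := by rw [hK_def, hK₀_def]; ring
  have hS0 : 0 < α₀ + α₁ := add_pos hα₀ hα₁
  have hKpos : 0 < K := by rw [hKK₀]; exact mul_pos hK₀ hS0
  have hα₀P : α₀ ≤ cP := by linarith only [hα₁, hs, min_le_left cP (cP / K₀)]
  have hKP : K ≤ cP := by
    have h1 : α₀ + α₁ ≤ cP / K₀ := hs.trans (min_le_right _ _)
    calc K = K₀ * (α₀ + α₁) := hKK₀
      _ ≤ K₀ * (cP / K₀) := mul_le_mul_of_nonneg_left h1 hK₀.le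
      _ = cP := by field_simp
  -- the datum is a datum of `SockB9P3D4` at level `m`
  have hWu : ∀ x κ, W x κ ∈ unitaryUnits 𝔸 := B8Prop3GaugeFixedKLevel.mem_unitaryUnits_of_mgauge_eq hU₀ hU' hu hW
  have h33m : InAk L m η α₀ Ω U₀ := fun j hj => h33 j (hj.trans hmk)
  have h34m : InAk L m η α₀ Ω (mulCfg W U₀) := by
    have h1 : InAk L m η α₀ Ω (mulCfg U' U₀) := fun j hj => h34 j (hj.trans hmk)
    have hui : ∀ x, u⁻¹ x ∈ U1 𝔸 := fun x => unitaryUnits_le_U1 ((unitaryUnits 𝔸).inv_mem (hu x))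
    rw [B8Prop3GaugeFixedKLevel.mulCfg_eq_gaugeAct_of_mgauge_eq hW]
    exact (B8Ineq132.inAk_gaugeAct_iff L m η α₀ Ω hui _).2 h1
  obtain ⟨ha, hg, -, -⟩ := H m hmk α₀ K hα₀ hα₀P hKpos hKP U₀ W hU₀ hWu h33m h34m hLan A' hsa hWA hA0
  exact ⟨ha, hg⟩

#print axioms sockH59Dβ_of_allLevelsD4β

/-! ## §3 The β socket is monotone in `B₀` -/

omit [Nontrivial 𝔸] in
/-- The four-line collar socket in edition β, `SockB9P3D4β` (dag-n06-b, p541339), is MONOTONE in its constant `B₀`: its right-hand sides are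
`B₀·(|J|₍₋₃₎ + |B₁|β) + B_∂Φ₀` with `|J|₍₋₃₎ + |B₁|β ≥ 0` (p537045's `sockB9P3D4_mono_B₀` with one token). [cite: Balaban1985RegularSpaces, (1.59) p.86] -/
theorem sockB9P3D4β_mono_B₀ {L : ℕ} {B₀ B₀s Bbd cP : ℝ} (hB : B₀ ≤ B₀s) {η : ℝ} (hη : 0 ≤ η) {k : ℕ} {Ω : ℕ → Set (Site d)}
    {Λs : ℕ → ℕ → Set (Site d)} {Λb : ℕ → ℕ → Set (Site d × Fin d)} (S : SockB9P3D4β (𝔸 := 𝔸) L B₀ Bbd cP η k Ω Λs Λb) :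
    SockB9P3D4β (𝔸 := 𝔸) L B₀s Bbd cP η k Ω Λs Λb := by
  intro α₀ α₂ hα₀ hα₀c hα₂ hα₂c U₀ W hU₀ hW hA hAW hLan A' hsa hWA hA0
  obtain ⟨l₁, l₂, l₃, l₄⟩ := S α₀ α₂ hα₀ hα₀c hα₂ hα₂c U₀ W hU₀ hW hA hAW hLan A' hsa hWA hA0
  have hX : 0 ≤ B8ScaledSupNorm.bondNorm L k η (-(3 : ℝ)) Ω (fun x μ => B8Eq155JBound.Jcur η U₀ A' μ x)
      + B8Eq155JBound.wsup 1 (fun p : {p : ℕ × (Site d × Fin d) // p.1 ≤ k ∧ (p.2 ∈ Λb k p.1 ∨ (p.1 = 0 ∧ CrossB (Ω 0) p.2))} =>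
          B7Prop4GeneralLevels.linCovIter L U₀ (B8Eq146AExpansion.iEta η A') p.1.1 p.1.2.1 p.1.2.2) :=
    add_nonneg (B8ScaledSupNorm.msup_nonneg L k hη _ _ _) (B8Eq155JBound.wsup_nonneg zero_le_one _)
  have hmono := mul_le_mul_of_nonneg_right hB hX
  exact ⟨l₁.trans (by linarith), l₂.trans (by linarith), l₃.trans (by linarith), l₄.trans (by linarith)⟩

/-! ## §4 The binder-agnostic form: Proposition 6 on the cube members from ANY all-levels four-line β socket family on the cube sub-family -/

/-- ★★ **PROPOSITION 6 ON THE CUBE MEMBERS FROM AN ALL-LEVELS FOUR-LINE β SOCKET FAMILY ON THE CUBE SUB-FAMILY — BINDER-AGNOSTIC, WINDOW-FREE,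
`H4`-FREE.**  p537045's `prop6Printed_zdCub_of_sockD4Family` with the socket token `SockB9P3D4 ↦ SockB9P3D4β` (dag-lead RULING №189 (2)): whatever supplies,
for SOME constants `B₀` (any real), `B_∂ ≥ 0`, `cP₉ > 0`, the β collar socket `SockB9P3D4β L B₀ B_∂ cP₉` at EVERY member of the cube sub-family of (1.131)
and EVERY truncation `m ≤ k` (today: dag-n06-b's `sockB9P3D4β_allLevels_of_thm33_on` from `B9.Thm33Printed` + six member-local binders, A6-witnessed at
`m = 0` by `B9SupplySockB9P3ZdBeta.Witness.sockB9P3D4β_at_nonvacuous_cube_zero`) gives, together with Proposition 5's three sockets at the ENLARGED constant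
`B₀ˢ = max{max{1, B₀}, 4B_∂/(dL − 1)}` (so `B₀ ≤ B₀ˢ`, `1 ≤ B₀ˢ`, and the absorption window `4B_∂ ≤ (dL − 1)B₀ˢ` holds identically — NO «`L` large»
proviso), a threshold `c₁ > 0` with `B8.Prop6Printed d L (5dL·B₀ˢ) c₁` on `zdCub ∘ f` for every cube index `f`.  Unlike the R-d edition, this is NOT a
one-token swap underneath: the consumers bound the crossing terms of `|B₁|β` (this seat's `…BdryBeta` files) and Theorem 4's chain is re-run in β with the
boundary-layer law discharged at the cubes (`bdryLayer_cubeSubfamily`).  Proof: `sockB9P3D4β_mono_B₀`, `sockH59Dβ_of_allLevelsD4β`, the cube-of-`f` member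
term, thresholds merged by antitonicity, into `prop6Printed_zdCub_bdry₅β_d4`.
[cite: Balaban1985RegularSpaces, Prop. 6 p.99, Prop. 3 p.87, Thm 4 p.88, Prop. 5 p.94, (1.58)–(1.62) pp.86–87, (1.31) p.82] -/
theorem prop6Printed_zdCub_of_sockD4βFamily (hd2 : 2 ≤ d) {L : ℕ} (hL : 2 ≤ L) {B₀ Bbd cP₉ B₀' C₂ cu cP : ℝ} (hBbd : 0 ≤ Bbd) (hcP₉ : 0 < cP₉) (hB₀' : 0 < B₀') (hC₂ : 2097152 * ((d : ℝ) + 1) ^ 2 ≤ C₂) (hcu : 0 < cu) (hcP : 0 < cP)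
    (hall : ∀ (j : {i : ZdIdx d L // ∃ (a : Site d) (M ρ : ℕ), L ≤ ρ ∧ ρ ≤ M ∧ 11 * d < M ∧ L ≤ d * M ∧
          i.Ω = cubeFam false L a M ρ i.k ∧ i.Λs = cubeLamS L a M ρ i.k ∧ i.Λb = cubeLamB L a M ρ i.k}) (m : ℕ), m ≤ j.1.k →
      SockB9P3D4β (𝔸 := 𝔸) L B₀ Bbd cP₉ j.1.η m j.1.Ω j.1.Λs j.1.Λb)
    (SP5base : ∀ i : {i : ZdIdx d L // ∃ (a : Site d) (M ρ : ℕ), L ≤ ρ ∧ ρ ≤ M ∧ 11 * d < M ∧ L ≤ d * M ∧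
          i.Ω = cubeFam false L a M ρ i.k ∧ i.Λs = cubeLamS L a M ρ i.k ∧ i.Λb = cubeLamB L a M ρ i.k},
      SockP5base (𝔸 := 𝔸) L (max (max 1 B₀) (4 * Bbd / ((d : ℝ) * L - 1))) B₀' cP i.1.η i.1.k i.1.Ω i.1.Λs)
    (SP5 : ∀ i : {i : ZdIdx d L // ∃ (a : Site d) (M ρ : ℕ), L ≤ ρ ∧ ρ ≤ M ∧ 11 * d < M ∧ L ≤ d * M ∧
          i.Ω = cubeFam false L a M ρ i.k ∧ i.Λs = cubeLamS L a M ρ i.k ∧ i.Λb = cubeLamB L a M ρ i.k},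
      SockP5 (𝔸 := 𝔸) L (max (max 1 B₀) (4 * Bbd / ((d : ℝ) * L - 1))) B₀' cP i.1.η i.1.k i.1.Ω i.1.Λs)
    (SP5u : ∀ i : {i : ZdIdx d L // ∃ (a : Site d) (M ρ : ℕ), L ≤ ρ ∧ ρ ≤ M ∧ 11 * d < M ∧ L ≤ d * M ∧
          i.Ω = cubeFam false L a M ρ i.k ∧ i.Λs = cubeLamS L a M ρ i.k ∧ i.Λb = cubeLamB L a M ρ i.k},
      SockP5u (𝔸 := 𝔸) L cP cu i.1.η i.1.k i.1.Ω i.1.Λs) :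
    ∃ c₁ : ℝ, 0 < c₁ ∧ ∀ {ι' : Type} (f : ι' → ZdIdx d L),
      B8.Prop6Printed d (L : ℝ) (5 * (d : ℝ) * L * (max (max 1 B₀) (4 * Bbd / ((d : ℝ) * L - 1)))) c₁ (fun j => zdCub 𝔸 L (f j)) := by
  have hL1 : 1 ≤ L := le_trans (by norm_num) hL
  have hd1 : 1 ≤ d := le_trans (by norm_num) hd2
  have hLr : (2 : ℝ) ≤ L := by exact_mod_cast hL
  have hdr : (2 : ℝ) ≤ d := by exact_mod_cast hd2
  have hdL : (0 : ℝ) < (d : ℝ) * L - 1 := by nlinarith [hLr, hdr]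
  -- the ENLARGED constant
  set B₀S : ℝ := max (max 1 B₀) (4 * Bbd / ((d : ℝ) * L - 1)) with hB₀S_def
  have hB₀S1 : 1 ≤ B₀S := (le_max_left 1 B₀).trans (le_max_left _ _)
  have hB₀S : 0 < B₀S := lt_of_lt_of_le one_pos hB₀S1
  have hDS : B₀ ≤ B₀S := (le_max_right 1 B₀).trans (le_max_left _ _)
  obtain ⟨inp, hinp, hinp'⟩ : ∃ inp : B8.B9Inputs, inp.B₀ = B₀S ∧ inp.B₀' = B₀' := ⟨⟨B₀S, B₀', hB₀S, hB₀'⟩, rfl, rfl⟩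
  have hB : 2 ≤ 5 * (d : ℝ) * L * inp.B₀ := by
    rw [hinp]
    have h1 : (2 : ℝ) ≤ 5 * (d : ℝ) * L := by nlinarith [hLr, hdr]
    nlinarith [h1, hB₀S1]
  -- the absorption window holds IDENTICALLY at the enlarged constant
  have hBd : 4 * Bbd ≤ ((d : ℝ) * L - 1) * inp.B₀ := by
    rw [hinp]
    have h1 : 4 * Bbd / ((d : ℝ) * L - 1) ≤ B₀S := le_max_right _ _
    have h2 : 4 * Bbd = ((d : ℝ) * L - 1) * (4 * Bbd / ((d : ℝ) * L - 1)) := by field_simp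
    rw [h2]
    exact mul_le_mul_of_nonneg_left h1 hdL.le
  -- the socket family, moved to the enlarged constant
  have hallS : ∀ (j : {i : ZdIdx d L // ∃ (a : Site d) (M ρ : ℕ), L ≤ ρ ∧ ρ ≤ M ∧ 11 * d < M ∧ L ≤ d * M ∧
      i.Ω = cubeFam false L a M ρ i.k ∧ i.Λs = cubeLamS L a M ρ i.k ∧ i.Λb = cubeLamB L a M ρ i.k}) (m : ℕ), m ≤ j.1.k →
      SockB9P3D4β (𝔸 := 𝔸) L B₀S Bbd cP₉ j.1.η m j.1.Ω j.1.Λs j.1.Λb :=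
    fun j m hm => sockB9P3D4β_mono_B₀ hDS (j.1.hη).le (hall j m hm)
  -- the merged threshold
  set c59 : ℝ := min cP₉ (cP₉ / (2 * (L * (5 * (d : ℝ) * L * B₀S)) + 8 * (8 * B₀' * (5 * (d : ℝ) * L * B₀S)))) with hc59_def
  have hK₀ : 0 < 2 * (L * (5 * (d : ℝ) * L * B₀S)) + 8 * (8 * B₀' * (5 * (d : ℝ) * L * B₀S)) := by
    have h1 : 0 < 2 * (L * (5 * (d : ℝ) * L * B₀S)) := by positivity
    have h2 : 0 ≤ 8 * (8 * B₀' * (5 * (d : ℝ) * L * B₀S)) := by positivity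
    linarith
  have hc59 : 0 < c59 := lt_min hcP₉ (div_pos hcP₉ hK₀)
  set cPs : ℝ := min cP c59 with hcPs_def
  have hcPs : 0 < cPs := lt_min hcP hc59
  have hcPsP : cPs ≤ cP := min_le_left _ _
  have hcPs9 : cPs ≤ c59 := min_le_right _ _
  obtain ⟨c₁, hc₁, G⟩ := prop6Printed_zdCub_bdry₅β_d4 (𝔸 := 𝔸) hd2 hL inp (C₂ := C₂) (cB9 := cP₉) (cu := cu) (cP := cPs)
    (Bbd := Bbd) hB hC₂ hcP₉ hcu hcPs hBbd hBd
    (fun i => by rw [hinp, hinp']; exact sockP5base_anti hcPsP (SP5base i))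
    (fun i => by rw [hinp, hinp']; exact sockP5_anti hcPsP (SP5 i))
    (fun i α₀ α₁ hα₀ hα₁ hle => by
      rw [hinp, hinp']
      exact sockH59Dβ_of_allLevelsD4β hd1 hL1 hB₀S hB₀'.le hcP₉ (fun m hm => hallS i m hm) α₀ α₁ hα₀ hα₁ (hle.trans hcPs9))
    (fun i => sockP5u_anti hcPsP (SP5u i))
  refine ⟨c₁, hc₁, fun f => ?_⟩
  have hP := G f (fun jf c => by
    rw [hinp]
    exact hallS ⟨⟨(f jf).η, (f jf).hη, c.k, c.one_le_k, cubeFam false L c.a c.M c.ρ c.k, hΩ_cubeFam hL1 c.a c.M c.L_le_ρ c.k,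
      cubeLamS L c.a c.M c.ρ c.k, cubeLamB L c.a c.M c.ρ c.k, hbox_cubeLamB L c.a c.M c.ρ c.k, hclass_cubeLamB L c.a c.M c.ρ c.k,
      htower_cubeLam hL1 c.a c.M c.ρ c.k, hpart_cubeLam hL1 c.a c.M c.ρ c.k⟩,
      ⟨c.a, c.M, c.ρ, c.L_le_ρ, c.ρ_le_M, c.big, c.L_le_dM, rfl, rfl, rfl⟩⟩ c.k le_rfl)
  rw [hinp] at hP
  exact hP

#print axioms sockB9P3D4β_mono_B₀
#print axioms prop6Printed_zdCub_of_sockD4βFamily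

end Literature.MathematicalPhysics.QuantumFieldTheory.Balaban1983to89.B8LeafKnitZd3CubBdryBeta

end

/-! ## HONEST SCOPE — VACUOUS AS TYPED (2026-08-27, seat `pub-ymgap-dag-n05-e` g9; director-ym LINE №196, dag-lead DEDUP-349∕350)

Every theorem of this file whose hypotheses contain a (1.59)-type clause or socket in EDITION β at a CUBE MEMBER of (1.131) — the SCALAR clauses
SC2∕SC4, the 𝔸-valued sockets `SockB9P3D4β` ∕ `H59Dβ` ∕ the four-line Prop.-3-frame socket, or a hypothesis SET that yields them (`B9.Thm33Printed` +
dag-n06-b's member-local binders at every truncation) — is VACUOUS AS TYPED: the averaging datum is read over `B8CubeMemberZd.cubeLamB`, whose condition 1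
«fine box ⊂ □_j» EMPTIES print's crossing bonds of (1.31) at levels `j ≥ 1`, and the interior SHELL GAUGE MODES `∂(𝟙λ)`, `λ ⊂ □_j`, then defeat the clause at
every cube member with `k ≥ 1` for ALL constants `B₀, B_∂` — KERNEL CERTIFICATE dag-n05-c `B8Ineq159FlatShellModeVacuity` (p572834:
`not_flat159β_two_cubeMember(_one)`, `sc2_uninhabited_cubeB8`; ref-E g12 READ-11 A6-FINAL), `Ω₀ = ℤᵈ` twin `…ShellModeVacuityUniv` (p576185).  The theorems
stay TRUE and PASS-AS-DECLARED; their content at cube members is nil.  Nothing of [Balaban1985RegularSpaces] is refuted: print's class ([B6] (2.3), «at least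
one end-point in Ω_j^{(j)}») contains the crossing bonds and kills the modes (dag-n05-c `B8Ineq159FlatShellModeCrossingDatum`).  SUPERSEDED BY EDITION γ: the
datum class of record becomes dag-n05-c's `B8Ineq159FlatCubeMemberPrinted.cubeLamBP` (p573921∕p575549), the socket dag-n06-b's `B9SupplySockB9P3ZdGamma`, the
Theorem-4 driver this seat's `B8Eq142KLevelLocalGamma` ∕ `B8Thm4KLevelGamma`; this file is kept as history and for its class-independent mechanics
(composition shape, ⊗-id transfer, the level-0 crossing MOVE), re-run by token swap in γ.  Count-neutral; N05 NOT discharged; nothing continuum ∕ ℝ⁴ ∕ OS ∕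
mass-gap ∕ Clay. -/
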